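import Literature.Analysis.FluidPDE.KatoLaiLowerEnergy
import HarnessLib

/-!
# Kato–Lai in the periodic cylinder: restart data and uniqueness along paths

Analysis/FluidPDE support file for the energy-method construction of Euler flows in the
periodic cylinder (`Literature.Analysis.FluidPDE.KatoLai1984_periodicCylinderUniformExistence`;
Kato–Lai 1984, §5 (5.12)–(5.13): the choice `ε² = (Φ²_{s₀} + k²)/Φ_s²` making the compressed norm
of the datum comparable to its `H^{s₀}` norm, and §6, proof of Thm II: restarting from `u(T₂)`).

* `psOp = diag (√p_s / w)` and `reweight : SymL2 →L SymL2`, the change of weight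
  `w_ε ↦ w_{ε′}` (`0 < ε′ ≤ ε`): `embed_reweight` (same physical coefficients),
  `norm_reweight_sq = ‖D f‖² + ε′² ‖S f‖²`, `d3Op_reweight` (same level-`3` energy),
  `exists_restart_eps` — **the restart datum**: some `ε′ ∈ (0, ε]` with `‖reweight f‖² ≤ ‖D f‖² + 1`;
* `IsCellPath` — a continuous `L²(cell)`-valued path on `[0, T]` which at every `t < T` is,
  to the right, the cell velocity of a solution in duality form of some level-`s` problem with
  vanishing gradient part and bounded `H`-norm; `IsCellPath.eq` — **uniqueness of cell paths**
  with the same initial value (Grönwall, as in `KatoLaiCellUniqueness`).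

Everything is proved; no named fact and no `sorry` is introduced.

## References

* T. Kato, C. Y. Lai, J. Funct. Anal. 56 (1984) 15–28, §5, §6. [KatoLai1984]
-/

noncomputable section

open MeasureTheory Set Function Filter Topology TopologicalSpace Finset
open scoped NNReal ENNReal InnerProductSpace RealInnerProductSpace

namespace Literature.Analysis.FluidPDE

open FunctionSpaces FunctionSpaces.Torus UnitAddTorus

/-- Local notation for physical space `ℝ³ = EuclideanSpace ℝ (Fin 3)`. -/
local notation "ℝ³" => EuclideanSpace ℝ (Fin 3)

namespace PeriodicCylinder

/-! ### The level-`s` part of the norm -/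

/-- The symbol `√p_s / w_ε` (`≤ 1/|ε|`). [folklore] -/
def psSymbol (s : ℕ) (ε : ℝ) (k : Fin 3 → ℤ) : ℝ := Real.sqrt (pureSq s k) * (klWeight s ε k)⁻¹

/-- `0 < psSymbol`. [folklore] -/
theorem psSymbol_pos (s : ℕ) (ε : ℝ) (k : Fin 3 → ℤ) : 0 < psSymbol s ε k :=
  mul_pos (Real.sqrt_pos.2 (lt_of_lt_of_le one_pos (one_le_pureSq s k))) (inv_pos.2 (klWeight_pos s ε k))

/-- `|psSymbol| ≤ 1/|ε|`. [folklore] -/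
theorem abs_psSymbol_le (s : ℕ) {ε : ℝ} (hε : ε ≠ 0) (k : Fin 3 → ℤ) : |psSymbol s ε k| ≤ 1 / |ε| := by
  have hε' : 0 < |ε| := abs_pos.2 hε
  rw [abs_of_pos (psSymbol_pos s ε k), psSymbol, mul_inv_le_iff₀ (klWeight_pos s ε k), klWeight]
  have hps : 0 ≤ pureSq s k := zero_le_one.trans (one_le_pureSq s k)
  rw [show 1 / |ε| * Real.sqrt (pureSq 3 k + ε ^ 2 * pureSq s k) = Real.sqrt ((pureSq 3 k + ε ^ 2 * pureSq s k) / ε ^ 2) by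
    rw [Real.sqrt_div' _ (sq_nonneg ε), Real.sqrt_sq_eq_abs]; ring]
  refine Real.sqrt_le_sqrt ?_
  rw [le_div_iff₀ (by positivity)]
  have : 0 ≤ pureSq 3 k := zero_le_one.trans (one_le_pureSq 3 k)
  nlinarith

/-- `psSymbol` is even. [folklore] -/
theorem psSymbol_neg (s : ℕ) (ε : ℝ) (k : Fin 3 → ℤ) : psSymbol s ε (-k) = psSymbol s ε k := by
  rw [psSymbol, psSymbol, pureSq_neg, (isWeight_klWeight s ε).even]

/-- `S = diag (√p_s/w)`: `‖S f‖²` is the pure level-`s` energy of the physical field. [folklore] -/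
def psOp (s : ℕ) {ε : ℝ} (hε : ε ≠ 0) : SymL2 (Fin 3) →L[ℝ] SymL2 (Fin 3) :=
  SymL2.diag (psSymbol s ε) (abs_psSymbol_le s hε) (psSymbol_neg s ε)

/-! ### The change of weight -/

section Reweight

variable (s : ℕ) {ε ε' : ℝ} (hε' : 0 < ε') (hle : ε' ≤ ε)

/-- The symbol `w_{ε′}/w_ε ∈ (0, 1]` for `0 < ε′ ≤ ε`. [folklore] -/
def rwSymbol (s : ℕ) (ε ε' : ℝ) (k : Fin 3 → ℤ) : ℝ := klWeight s ε' k * (klWeight s ε k)⁻¹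

/-- `0 < rwSymbol`. [folklore] -/
theorem rwSymbol_pos (k : Fin 3 → ℤ) : 0 < rwSymbol s ε ε' k := mul_pos (klWeight_pos s ε' k) (inv_pos.2 (klWeight_pos s ε k))

include hε' hle in
/-- `|rwSymbol| ≤ 1`. [folklore] -/
theorem abs_rwSymbol_le (k : Fin 3 → ℤ) : |rwSymbol s ε ε' k| ≤ 1 := by
  rw [abs_of_pos (rwSymbol_pos s k), rwSymbol, mul_inv_le_iff₀ (klWeight_pos s ε k), one_mul, klWeight, klWeight]
  refine Real.sqrt_le_sqrt ?_
  have hps : 0 ≤ pureSq s k := zero_le_one.trans (one_le_pureSq s k)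
  have : ε' ^ 2 ≤ ε ^ 2 := pow_le_pow_left₀ hε'.le hle 2
  nlinarith

/-- `rwSymbol` is even. [folklore] -/
theorem rwSymbol_neg (k : Fin 3 → ℤ) : rwSymbol s ε ε' (-k) = rwSymbol s ε ε' k := by
  rw [rwSymbol, rwSymbol, (isWeight_klWeight s ε).even, (isWeight_klWeight s ε').even]

/-- **The change of weight** `w_ε ↦ w_{ε′}`. [cite: KatoLai1984, §5 (5.13)] -/
def reweight : SymL2 (Fin 3) →L[ℝ] SymL2 (Fin 3) :=
  SymL2.diag (rwSymbol s ε ε') (abs_rwSymbol_le s hε' hle) (rwSymbol_neg s)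

/-- **The physical coefficients are unchanged**: `i_{ε′} (reweight f) = i_ε f`. [folklore] -/
theorem embed_reweight (f : SymL2 (Fin 3)) : embed s ε' (reweight s hε' hle f) = embed s ε f := by
  refine SymL2.ext fun k => ?_
  rw [embed_apply, embed_apply, reweight, SymL2.diag_apply, smul_smul, rwSymbol]
  congr 1
  have h1 : ((klWeight s ε' k : ℝ) : ℂ) ≠ 0 := by exact_mod_cast (klWeight_pos s ε' k).ne'
  push_cast
  field_simp

/-- **The level-`3` energy is unchanged**: `D_{ε′} (reweight f) = D_ε f`. [folklore] -/
theorem d3Op_reweight (f : SymL2 (Fin 3)) : d3Op s ε' (reweight s hε' hle f) = d3Op s ε f := by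
  refine SymL2.ext fun k => ?_
  rw [d3Op, d3Op, reweight, SymL2.diag_apply, SymL2.diag_apply, SymL2.diag_apply, smul_smul, d3Symbol, d3Symbol, rwSymbol]
  congr 1
  have h1 : ((klWeight s ε' k : ℝ) : ℂ) ≠ 0 := by exact_mod_cast (klWeight_pos s ε' k).ne'
  push_cast
  field_simp

/-- **The norm after the change of weight**: `‖reweight f‖² = ‖D f‖² + ε′² ‖S f‖²`. [cite: KatoLai1984, §5 (5.12)] -/
theorem norm_reweight_sq (hε : ε ≠ 0) (f : SymL2 (Fin 3)) :
    ‖reweight s hε' hle f‖ ^ 2 = ‖d3Op s ε f‖ ^ 2 + ε' ^ 2 * ‖psOp s hε f‖ ^ 2 := by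
  have h1 := SymL2.hasSum_norm_sq_diag (rwSymbol s ε ε') (abs_rwSymbol_le s hε' hle) (rwSymbol_neg s) f
  have h2 := SymL2.hasSum_norm_sq_diag (d3Symbol s ε) (abs_d3Symbol_le s ε) (d3Symbol_neg s ε) f
  have h3 := SymL2.hasSum_norm_sq_diag (psSymbol s ε) (abs_psSymbol_le s hε) (psSymbol_neg s ε) f
  refine h1.unique ((h2.add (h3.mul_left (ε' ^ 2))).congr_fun fun k => ?_)
  have hw := (klWeight_pos s ε k).ne'
  have hp3 : 0 ≤ pureSq 3 k := zero_le_one.trans (one_le_pureSq 3 k)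
  have hps : 0 ≤ pureSq s k := zero_le_one.trans (one_le_pureSq s k)
  rw [rwSymbol, d3Symbol, psSymbol, mul_pow, mul_pow, mul_pow, klWeight_sq s ε', Real.sq_sqrt hp3, Real.sq_sqrt hps]
  ring

/-- **The restart parameter**: for `ε ≠ 0` and `f`, some `ε′ ∈ (0, |ε|]` with `ε′² ‖S f‖² ≤ 1`. [cite: KatoLai1984, §5 (5.13)] -/
theorem exists_restart_eps (hε : ε ≠ 0) (f : SymL2 (Fin 3)) : ∃ ε₁ : ℝ, 0 < ε₁ ∧ ε₁ ≤ |ε| ∧ ε₁ ^ 2 * ‖psOp s hε f‖ ^ 2 ≤ 1 := by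
  set P := ‖psOp s hε f‖ ^ 2 with hP
  have hP0 : 0 ≤ P := sq_nonneg _
  refine ⟨min |ε| (1 / Real.sqrt (P + 1)), lt_min (abs_pos.2 hε) (by positivity), min_le_left _ _, ?_⟩
  have h1 : min |ε| (1 / Real.sqrt (P + 1)) ≤ 1 / Real.sqrt (P + 1) := min_le_right _ _
  have h0 : 0 ≤ min |ε| (1 / Real.sqrt (P + 1)) := le_min (abs_nonneg _) (by positivity)
  have h2 : min |ε| (1 / Real.sqrt (P + 1)) ^ 2 ≤ (1 / Real.sqrt (P + 1)) ^ 2 := pow_le_pow_left₀ h0 h1 2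
  rw [div_pow, one_pow, Real.sq_sqrt (by positivity)] at h2
  calc min |ε| (1 / Real.sqrt (P + 1)) ^ 2 * P ≤ 1 / (P + 1) * P := mul_le_mul_of_nonneg_right h2 hP0
    _ ≤ 1 := by rw [div_mul_eq_mul_div, one_mul, div_le_one (by positivity)]; linarith

end Reweight

/-! ### Cell paths and their uniqueness -/

section Path

variable {L : ℝ} (hL : 0 < L)

/-- **A cell path** on `[0, T]` with bound `ρ`: a continuous `L²(cell)`-valued path with
vanishing gradient part which, at every `t ∈ [0, T)`, is to the right the cell velocity of a
solution in duality form of some level-`s` problem, of `H`-norm at most `ρ`: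
`V t = R (i f)` and `d⁺V/dt = −R (𝒜̂ f)`. [cite: KatoLai1984, §6 (proof of Thm II)] -/
structure IsCellPath (ρ T : ℝ) (V : ℝ → Lp ℝ³ 2 (cellMeasure L)) : Prop where
  /-- continuity on the closed interval -/
  continuousOn : ContinuousOn V (Icc 0 T)
  /-- the gradient part vanishes -/
  grad_free : ∀ t ∈ Icc 0 T, helmholtzProj L (V t) = 0
  /-- the right derivative is given by Kato–Lai's operator at some level -/
  deriv : ∀ t ∈ Ico 0 T, ∃ (s : ℕ) (ε : ℝ) (f : SymL2 (Fin 3)), ‖f‖ ≤ ρ ∧ cellRestrict hL (embed s ε f) = V t ∧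
    HasDerivWithinAt V (-cellRestrict hL (klOpExt hL s ε f)) (Ici t) t

/-- **Uniqueness of cell paths** (Kato–Lai p. 23, by Grönwall). [cite: KatoLai1984, §5 (p. 23), §6] -/
theorem IsCellPath.eq {ρ₁ ρ₂ T : ℝ} {V₁ V₂ : ℝ → Lp ℝ³ 2 (cellMeasure L)} (h₁ : IsCellPath hL ρ₁ T V₁) (h₂ : IsCellPath hL ρ₂ T V₂)
    (h0 : V₁ 0 = V₂ 0) : ∀ t ∈ Icc 0 T, V₁ t = V₂ t := by
  obtain ⟨K', hK'0, hK'⟩ := exists_abs_inner_velCell_sub_le hL ρ₂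
  set D : ℝ → Lp ℝ³ 2 (cellMeasure L) := fun t => V₁ t - V₂ t with hD
  set F : ℝ → ℝ := fun t => ⟪D t, D t⟫_ℝ with hF
  -- a right derivative of `F` with the bound `|F'| ≤ 2 K' F`
  have hstep : ∀ t ∈ Ico 0 T, ∃ F't : ℝ, HasDerivWithinAt F F't (Ici t) t ∧ ‖F't‖ ≤ 2 * K' * ‖F t‖ + 0 := by
    intro t ht
    obtain ⟨s₁, ε₁, f₁, -, hV₁, hd₁⟩ := h₁.deriv t ht
    obtain ⟨s₂, ε₂, f₂, hf₂, hV₂, hd₂⟩ := h₂.deriv t ht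
    have hDd : HasDerivWithinAt D (-(cellRestrict hL (klOpExt hL s₁ ε₁ f₁) - cellRestrict hL (klOpExt hL s₂ ε₂ f₂))) (Ici t) t := by
      have h := hd₁.sub hd₂
      have e : -(cellRestrict hL (klOpExt hL s₁ ε₁ f₁) - cellRestrict hL (klOpExt hL s₂ ε₂ f₂)) =
          -cellRestrict hL (klOpExt hL s₁ ε₁ f₁) - -cellRestrict hL (klOpExt hL s₂ ε₂ f₂) := by abel
      rw [e]; exact h
    refine ⟨-(2 * ⟪D t, cellRestrict hL (klOpExt hL s₁ ε₁ f₁) - cellRestrict hL (klOpExt hL s₂ ε₂ f₂)⟫_ℝ), ?_, ?_⟩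
    · have h := hDd.inner (𝕜 := ℝ) hDd
      refine h.congr_deriv ?_
      rw [inner_neg_right, inner_neg_left, real_inner_comm (D t)]
      ring
    · have htI : t ∈ Icc 0 T := ⟨ht.1, ht.2.le⟩
      have hQD : helmholtzProj L (cellRestrict hL (embed s₁ ε₁ f₁) - cellRestrict hL (embed s₂ ε₂ f₂)) = 0 := by
        rw [hV₁, hV₂, map_sub, h₁.grad_free t htI, h₂.grad_free t htI, sub_zero]
      have h := hK' s₁ s₂ ε₁ ε₂ f₁ f₂ hf₂ hQD
      rw [hV₁, hV₂] at h
      have hFx : ‖F t‖ = ‖D t‖ ^ 2 := by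
        rw [hF]; simp only; rw [real_inner_self_eq_norm_sq, Real.norm_of_nonneg (sq_nonneg _)]
      rw [add_zero, hFx, norm_neg, Real.norm_eq_abs, abs_mul, abs_two]
      have : |⟪D t, cellRestrict hL (klOpExt hL s₁ ε₁ f₁) - cellRestrict hL (klOpExt hL s₂ ε₂ f₂)⟫_ℝ| ≤ K' * ‖D t‖ ^ 2 := h
      nlinarith
  choose! F' hF'd hF'b using hstep
  have hFc : ContinuousOn F (Icc 0 T) := by
    have hDc : ContinuousOn D (Icc 0 T) := h₁.continuousOn.sub h₂.continuousOn
    exact hDc.inner (𝕜 := ℝ) hDc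
  have hF0 : ‖F 0‖ ≤ 0 := by
    have : D 0 = 0 := by simp [hD, h0]
    simp [hF, this]
  intro t ht
  have hG := norm_le_gronwallBound_of_norm_deriv_right_le hFc hF'd hF0 hF'b t ht
  rw [gronwallBound_ε0_δ0] at hG
  have hF0' : F t = 0 := norm_eq_zero.1 (le_antisymm hG (norm_nonneg _))
  have : D t = 0 := inner_self_eq_zero.1 hF0'
  exact sub_eq_zero.1 this

end Path


end PeriodicCylinder

end Literature.Analysis.FluidPDE
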